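import Summits.HubbardSuperconductivity.HubbardSuperconductivity.Theorems.NodalWardXYPerturbedXYOrderRelTwistedBounds

/-!
# Crux `PerturbedXYOrder` (stmt-HubbardSuperconductivity-10739): even within Balaban's RELATIVELY BOUNDED invariant class, spatial decay is
# load-bearing — the energy-weighted invariant mean-field source `(s/L³)R` is NOT uniformly zero-free (Goldstone pinching; lead c19,
# line `schwarz-inheritance`, registered stub `stub_invariantRelBoundedPinching`)

Sequel to `Negative/InvariantMeanFieldPinching.lean` (p156901: the invariant source `sL³|m_L|²` is not uniformly zero-free).  That source is
not bounded by the gradient energy, so it lies outside the relatively bounded class `|W| ≤ C Σ_b (1 − cos ∇_bθ)` that the crux advertises for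
`W_K` (Balaban's small/large-field condition) — a class in which one might still hope that invariance + smallness suffice.  This file removes
the loophole with the Ward observable of lead c18,

  `R(θ) = Σ_y Σ_b (cos(θ_{b₁} − θ_y) + cos(θ_{b₂} − θ_y)) (1 − cos ∇_bθ)`,   `|R| ≤ 2L³ Σ_b (1 − cos ∇_bθ)` (`gr_abs_R_le_energy`),

proving (`perturbedXYOrder_false_for_invariant_relBounded_source`, alias of the registered stub `stub_invariantRelBoundedPinching`)

  `¬ ∃ J₀ ε > 0, ∀ J ≥ J₀, ∀ L ≥ 2, ∀ s ∈ ℂ, ‖s‖ ≤ ε → ∫_cube w_J e^{(s/L³) R} dθ ≠ 0`.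

The tilt `(s/L³)R` is O(2)-invariant, relatively form-bounded with constant `2|s|`, bounded by `12|s|L³`, of mean-field range.  So the list of
typed edges of `PerturbedXYOrder` reads: low temperature (p73198) · decay exponent 4 (p122024) · invariance (p151347, p153499) · DECAY among
invariant tilts (p156901), now sharpened to: decay among invariant RELATIVELY BOUNDED tilts.  Engine statements for this crux must carry a
genuine spatial decay / quasi-locality norm; "invariant + relatively bounded + small" is refutable.

Proof.  `G(s) = Z(s)Z(−s)/Z(0)²` is entire, even, zero-free on `‖s‖ < ε` under the hypothesis and `‖G‖ ≤ e^{24εL³}`, so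
`log‖G(σ)‖ ≤ 192 L³σ²/ε` for `0 < σ < ε/2` (`cfp_log_norm_le_of_zeroFree`, p151006).  From below: the Ward–Jensen side
`log Z(σ)/Z(0) ≥ σ(a₀L³ − 1)/J` (`gr_rel_lower_pos`: Jensen + `⟨R⟩_J = (L⁶ Re cratio − L³)/J` from the rotator Ward identity p153040 +
`realPlateau` p86048) and the twisted side `log Z(−σ)/Z(0) ≥ −18σL³/n − 4π²σn⁴L − 4πσn²L² − 2π²n⁴JL` (`gr_rel_lower_neg`: Mermin–Wagner twists
`g_k`, `k ≤ n²`, AM–GM against the character-sum bound).  With `J = max(J₀,J₁,1)`, `n = ⌈36J/a₀⌉₊ + 1`, `σ = a₀ε/(768J)`: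
`L³a₀/(4J) ≤ C₀L²`, `C₀ = 1/J + 4π²n⁴ + 4πn² + 2π²n⁴J/σ`, i.e. `L ≤ 4JC₀/a₀` — false at `L = max(n²+1, ⌈4JC₀/a₀⌉₊+2)`.
-/

noncomputable section

namespace Summit.HubbardSuperconductivity.HubbardSuperconductivity.Theorems.PerturbedXYOrder

open MeasureTheory Literature.Probability.LatticeModels Metric Set
open Summit.HubbardSuperconductivity.HubbardSuperconductivity.Theses.NodalWardXY

variable {L : ℕ}

/-- The complex source is the real source. -/
theorem gr_source_real [NeZero L] (θ : TorusSite 3 L → ℝ) :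
    (∑ y : TorusSite 3 L, ∑ b : Bond L, ((Real.cos (θ b.1 - θ y) : ℂ) + (Real.cos (θ (b.1 + Pi.single b.2 1) - θ y) : ℂ)) *
        (1 - (Real.cos (θ (b.1 + Pi.single b.2 1) - θ b.1) : ℂ))) =
      ((∑ y : TorusSite 3 L, ∑ b : Bond L, (Real.cos (θ b.1 - θ y) + Real.cos (θ (b.1 + Pi.single b.2 1) - θ y)) *
        (1 - Real.cos (θ (b.1 + Pi.single b.2 1) - θ b.1)) : ℝ) : ℂ) := by
  push_cast
  rfl

/-- For real `t` the tilted partition function is the real integral `∫ e^{t R/L³} w_J`. -/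
theorem gr_Zrel_real [NeZero L] (J t : ℝ) :
    (∫ θ in cube L, wJ J θ * Complex.exp ((t : ℂ) * ((∑ y : TorusSite 3 L, ∑ b : Bond L,
        ((Real.cos (θ b.1 - θ y) : ℂ) + (Real.cos (θ (b.1 + Pi.single b.2 1) - θ y) : ℂ)) *
          (1 - (Real.cos (θ (b.1 + Pi.single b.2 1) - θ b.1) : ℂ))) / (L : ℂ) ^ 3))) =
      ((∫ θ in cube L, Real.exp (t * ((∑ y : TorusSite 3 L, ∑ b : Bond L,
        (Real.cos (θ b.1 - θ y) + Real.cos (θ (b.1 + Pi.single b.2 1) - θ y)) *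
          (1 - Real.cos (θ (b.1 + Pi.single b.2 1) - θ b.1))) / (L : ℝ) ^ 3)) * (wJ J θ).re : ℝ) : ℂ) := by
  rw [← integral_complex_ofReal]
  refine integral_congr_ae (ae_of_all _ fun θ => ?_)
  dsimp only
  rw [gr_source_real, gp_wJ_re]
  unfold wJ
  have : (t : ℂ) * (((∑ y : TorusSite 3 L, ∑ b : Bond L, (Real.cos (θ b.1 - θ y) + Real.cos (θ (b.1 + Pi.single b.2 1) - θ y)) *
        (1 - Real.cos (θ (b.1 + Pi.single b.2 1) - θ b.1)) : ℝ) : ℂ) / (L : ℂ) ^ 3) =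
      ((t * ((∑ y : TorusSite 3 L, ∑ b : Bond L, (Real.cos (θ b.1 - θ y) + Real.cos (θ (b.1 + Pi.single b.2 1) - θ y)) *
        (1 - Real.cos (θ (b.1 + Pi.single b.2 1) - θ b.1))) / (L : ℝ) ^ 3) : ℝ) : ℂ) := by
    push_cast; ring
  rw [this, ← Complex.ofReal_exp]
  push_cast
  ring

/-- `‖R/L³‖ ≤ 12 L³` (as a complex number). -/
theorem gr_norm_source_le [NeZero L] (θ : TorusSite 3 L → ℝ) :
    ‖(∑ y : TorusSite 3 L, ∑ b : Bond L, ((Real.cos (θ b.1 - θ y) : ℂ) + (Real.cos (θ (b.1 + Pi.single b.2 1) - θ y) : ℂ)) *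
        (1 - (Real.cos (θ (b.1 + Pi.single b.2 1) - θ b.1) : ℂ))) / (L : ℂ) ^ 3‖ ≤ 12 * (L : ℝ) ^ 3 := by
  have hL0 : (0 : ℝ) < L := by have := NeZero.pos L; exact_mod_cast this
  have hL3 : ‖((L : ℂ)) ^ 3‖ = (L : ℝ) ^ 3 := by simp
  rw [norm_div, hL3, div_le_iff₀ (by positivity), gr_source_real, Complex.norm_real, Real.norm_eq_abs]
  have := gr_abs_R_le θ
  nlinarith [this]

/-- **Growth**: `‖Z(s)‖ ≤ e^{12‖s‖L³} Z(0)`. -/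
theorem gr_norm_Zrel_le [NeZero L] (J : ℝ) (s : ℂ) :
    ‖∫ θ in cube L, wJ J θ * Complex.exp (s * ((∑ y : TorusSite 3 L, ∑ b : Bond L,
        ((Real.cos (θ b.1 - θ y) : ℂ) + (Real.cos (θ (b.1 + Pi.single b.2 1) - θ y) : ℂ)) *
          (1 - (Real.cos (θ (b.1 + Pi.single b.2 1) - θ b.1) : ℂ))) / (L : ℂ) ^ 3))‖ ≤
      Real.exp (‖s‖ * (12 * (L : ℝ) ^ 3)) * ∫ θ in cube L, (wJ J θ).re := by
  rw [← integral_const_mul]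
  refine norm_integral_le_of_norm_le ((gp_integrable (gp_continuous_wJ_re J)).const_mul _) (ae_of_all _ fun θ => ?_)
  rw [norm_mul]
  have hw : ‖wJ J θ‖ = (wJ J θ).re := by
    rw [gp_wJ_re]; unfold wJ; rw [Complex.norm_real, Real.norm_eq_abs, Real.abs_exp]
  rw [hw, mul_comm]
  refine mul_le_mul_of_nonneg_right ?_ (gp_wJ_re_pos J θ).le
  refine (Complex.norm_exp_le_exp_norm _).trans (Real.exp_le_exp.2 ?_)
  rw [norm_mul]
  exact mul_le_mul_of_nonneg_left (gr_norm_source_le θ) (norm_nonneg _)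

/-- **Goldstone pinching — the RELATIVELY BOUNDED O(2)-invariant mean-field source is NOT uniformly zero-free** (registered stub
`stub_invariantRelBoundedPinching` of the line `schwarz-inheritance`, lead c19).  The tilt `W = (s/L³) R`,
`R = Σ_y Σ_b (cos(θ_{b₁} − θ_y) + cos(θ_{b₂} − θ_y))(1 − cos ∇_bθ)`, is O(2)-invariant, RELATIVELY FORM-BOUNDED
`|W| ≤ 2|s| Σ_b (1 − cos ∇_bθ)` (`gr_abs_R_le_energy`: Balaban's small/large-field class, exactly what the crux advertises for `W_K`), of
mean-field range; and

  `¬ ∃ J₀ ε > 0, ∀ J ≥ J₀, ∀ L ≥ 2, ∀ s ∈ ℂ, ‖s‖ ≤ ε → ∫_cube w_J e^{(s/L³) R} dθ ≠ 0`.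

Proof: as for the plain mean-field source (`stub_invariantMeanFieldPinching`), with the Jensen side supplied by the rotator WARD IDENTITY
(`gr_ward_R`: `⟨R⟩_J = (L⁶ Re cratio − L³)/J ≥ (a₀L⁶ − L³)/J`, p153040 + `realPlateau`) and the twisted side by `gr_rel_lower_neg`
(Mermin–Wagner twists `g_k`, `k ≤ n²`, AM–GM against the character-sum bound): `log‖G(σ)‖ ≥ σ(a₀L³ − 1)/J − 18σL³/n − O(σn⁴L²) − 2π²n⁴JL`
against `≤ 192 L³σ²/ε`; with `n ≥ 36J/a₀`, `σ = a₀ε/(768J)`: `L ≤ 4JC₀/a₀`.  So even within the relatively bounded invariant class the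
spatial DECAY of the kernel is load-bearing in `PerturbedXYOrder`. -/
theorem stub_invariantRelBoundedPinching :
    ¬ (∃ J₀ ε : ℝ, 0 < ε ∧ ∀ J : ℝ, J₀ ≤ J → ∀ (L : ℕ) [NeZero L], 2 ≤ L →
        ∀ s : ℂ, ‖s‖ ≤ ε →
          (∫ θ in cube L, wJ J θ * Complex.exp (s * ((∑ y : TorusSite 3 L, ∑ b : Bond L,
            ((Real.cos (θ b.1 - θ y) : ℂ) + (Real.cos (θ (b.1 + Pi.single b.2 1) - θ y) : ℂ)) *
              (1 - (Real.cos (θ (b.1 + Pi.single b.2 1) - θ b.1) : ℂ))) / (L : ℂ) ^ 3))) ≠ 0) := by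
  rintro ⟨J₀, ε, hε, h⟩
  obtain ⟨J₁, a₀, ha₀, hplat⟩ := realPlateau
  set J : ℝ := max (max J₀ J₁) 1 with hJ
  have hJ1 : 1 ≤ J := le_max_right _ _
  have hJpos : 0 < J := lt_of_lt_of_le one_pos hJ1
  have hJJ₀ : J₀ ≤ J := (le_max_left _ _).trans (le_max_left _ _)
  have hJJ₁ : J₁ ≤ J := (le_max_right _ _).trans (le_max_left _ _)
  -- `a₀ ≤ 1` (from any volume, e.g. `L = 2`)
  have ha1 : a₀ ≤ 1 := by
    haveI : NeZero (2 : ℕ) := ⟨by norm_num⟩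
    obtain ⟨hpl2, hn2⟩ := hplat J hJJ₁ 2 le_rfl
    exact hpl2.trans ((Complex.re_le_norm _).trans hn2)
  -- the number of twists `n²`, `n ≥ 36 J/a₀`
  set n : ℕ := ⌈36 * J / a₀⌉₊ + 1 with hndef
  have hn1 : 1 ≤ n := by rw [hndef]; omega
  have hn0 : (0 : ℝ) < n := by exact_mod_cast hn1
  have hna : 36 * J / a₀ ≤ n := by
    rw [hndef]; push_cast
    linarith [Nat.le_ceil (36 * J / a₀)]
  -- the pinch point and the volume
  set σ : ℝ := a₀ * ε / (768 * J) with hσ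
  have hσpos : 0 < σ := by positivity
  have hσε : σ < ε / 2 := by
    rw [hσ, div_lt_div_iff₀ (by positivity) (by norm_num)]
    nlinarith [mul_pos ha₀ hε]
  set C₀ : ℝ := 1 / J + 4 * Real.pi ^ 2 * (n : ℝ) ^ 4 + 4 * Real.pi * (n : ℝ) ^ 2 + 2 * Real.pi ^ 2 * (n : ℝ) ^ 4 * J / σ with hC₀
  have hC₀pos : 0 < C₀ := by positivity
  set B : ℝ := 4 * J * C₀ / a₀ with hB
  have hB0 : 0 ≤ B := by positivity
  set L : ℕ := max (n ^ 2 + 1) (⌈B⌉₊ + 2) with hLdef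
  have hL2 : 2 ≤ L := le_trans (by omega) (le_max_right _ _)
  have hnL : n ^ 2 < L := lt_of_lt_of_le (Nat.lt_succ_self _) (le_max_left _ _)
  haveI : NeZero L := ⟨by omega⟩
  have hL1r : (1 : ℝ) ≤ L := by exact_mod_cast (show 1 ≤ L by omega)
  have hBL : B < L := by
    have h1 : (⌈B⌉₊ + 2 : ℕ) ≤ L := le_max_right _ _
    have h2 : ((⌈B⌉₊ + 2 : ℕ) : ℝ) ≤ (L : ℝ) := by exact_mod_cast h1
    push_cast at h2
    linarith [Nat.le_ceil B]
  set N : ℝ := (L : ℝ) ^ 3 with hN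
  have hL0 : (0 : ℝ) < L := by positivity
  have hNpos : 0 < N := by positivity
  -- the plateau at `(J, L)`
  obtain ⟨hpl, hn1'⟩ := hplat J hJJ₁ L hL2
  -- the tilted partition function and its real version
  set Zs : ℂ → ℂ := fun s => ∫ θ in cube L, wJ J θ * Complex.exp (s * ((∑ y : TorusSite 3 L, ∑ b : Bond L,
    ((Real.cos (θ b.1 - θ y) : ℂ) + (Real.cos (θ (b.1 + Pi.single b.2 1) - θ y) : ℂ)) *
      (1 - (Real.cos (θ (b.1 + Pi.single b.2 1) - θ b.1) : ℂ))) / (L : ℂ) ^ 3)) with hZs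
  set Zr : ℝ → ℝ := fun t => ∫ θ in cube L, Real.exp (t * ((∑ y : TorusSite 3 L, ∑ b : Bond L,
    (Real.cos (θ b.1 - θ y) + Real.cos (θ (b.1 + Pi.single b.2 1) - θ y)) *
      (1 - Real.cos (θ (b.1 + Pi.single b.2 1) - θ b.1))) / (L : ℝ) ^ 3)) * (wJ J θ).re with hZr
  set Z₀ : ℝ := ∫ θ in cube L, (wJ J θ).re with hZ₀
  have hZ₀pos : 0 < Z₀ := gp_integral_wJ_re_pos J
  have hreal : ∀ t : ℝ, Zs t = ((Zr t : ℝ) : ℂ) := fun t => gr_Zrel_real J t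
  have hZr0 : Zr 0 = Z₀ := by
    simp only [hZr, hZ₀, zero_mul, Real.exp_zero, one_mul]
  have hZs0 : Zs 0 = ((Z₀ : ℝ) : ℂ) := by
    have := hreal 0
    rw [Complex.ofReal_zero] at this
    rw [this, hZr0]
  have hZs0_ne : Zs 0 ≠ 0 := by rw [hZs0, Ne, Complex.ofReal_eq_zero]; exact hZ₀pos.ne'
  have hZrpos : ∀ t : ℝ, 0 < Zr t := by
    intro t
    simp only [hZr]
    have hc : Continuous fun θ : TorusSite 3 L → ℝ => Real.exp (t * ((∑ y : TorusSite 3 L, ∑ b : Bond L,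
        (Real.cos (θ b.1 - θ y) + Real.cos (θ (b.1 + Pi.single b.2 1) - θ y)) *
          (1 - Real.cos (θ (b.1 + Pi.single b.2 1) - θ b.1))) / (L : ℝ) ^ 3)) * (wJ J θ).re :=
      (by fun_prop : Continuous fun θ : TorusSite 3 L → ℝ => Real.exp (t * ((∑ y : TorusSite 3 L, ∑ b : Bond L,
        (Real.cos (θ b.1 - θ y) + Real.cos (θ (b.1 + Pi.single b.2 1) - θ y)) *
          (1 - Real.cos (θ (b.1 + Pi.single b.2 1) - θ b.1))) / (L : ℝ) ^ 3))).mul (gp_continuous_wJ_re J)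
    have hint := gp_integrable (L := L) hc
    rw [integral_pos_iff_support_of_nonneg (fun θ => (mul_pos (Real.exp_pos _) (gp_wJ_re_pos J θ)).le) hint]
    have hsupp : Function.support (fun θ : TorusSite 3 L → ℝ => Real.exp (t * ((∑ y : TorusSite 3 L, ∑ b : Bond L,
        (Real.cos (θ b.1 - θ y) + Real.cos (θ (b.1 + Pi.single b.2 1) - θ y)) *
          (1 - Real.cos (θ (b.1 + Pi.single b.2 1) - θ b.1))) / (L : ℝ) ^ 3)) * (wJ J θ).re) = Set.univ :=
      Set.eq_univ_of_forall fun θ => (mul_pos (Real.exp_pos _) (gp_wJ_re_pos J θ)).ne'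
    rw [hsupp, Measure.restrict_apply_univ]
    exact volume_cube_pos
  have hZs_ne : ∀ s : ℂ, ‖s‖ ≤ ε → Zs s ≠ 0 := fun s hs => h J hJJ₀ L hL2 s hs
  have hZs_diff : Differentiable ℂ Zs := by
    haveI := ent_isFiniteMeasure_restrict_cube (L := L)
    have hW : Continuous fun θ : TorusSite 3 L → ℝ => (∑ y : TorusSite 3 L, ∑ b : Bond L,
        ((Real.cos (θ b.1 - θ y) : ℂ) + (Real.cos (θ (b.1 + Pi.single b.2 1) - θ y) : ℂ)) *
          (1 - (Real.cos (θ (b.1 + Pi.single b.2 1) - θ b.1) : ℂ))) / (L : ℂ) ^ 3 := by fun_prop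
    exact ent_differentiable_integral_mul_cexp (μ := volume.restrict (cube L))
      (ent_continuous_wJ J).aestronglyMeasurable hW.aestronglyMeasurable (ent_norm_wJ_le J)
      (fun θ => gr_norm_source_le θ)
  have hZs_norm : ∀ s : ℂ, ‖Zs s‖ ≤ Real.exp (‖s‖ * (12 * N)) * Z₀ := fun s => gr_norm_Zrel_le J s
  -- the symmetrised normalised function `G`
  set G : ℂ → ℂ := fun s => Zs s * Zs (-s) / Zs 0 ^ 2 with hG
  have hGd : DifferentiableOn ℂ G (ball 0 ε) :=
    ((hZs_diff.mul (hZs_diff.comp differentiable_neg)).div_const (Zs 0 ^ 2)).differentiableOn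
  have hG0 : ∀ z ∈ ball (0 : ℂ) ε, G z ≠ 0 := by
    intro z hz
    rw [mem_ball_zero_iff] at hz
    refine div_ne_zero (mul_ne_zero (hZs_ne z hz.le) (hZs_ne (-z) (by rw [norm_neg]; exact hz.le))) (pow_ne_zero _ hZs0_ne)
  have hG1 : G 0 = 1 := by
    simp only [hG, neg_zero]
    rw [pow_two, div_self (mul_ne_zero hZs0_ne hZs0_ne)]
  have hnormZs0 : ‖Zs 0‖ = Z₀ := by rw [hZs0, Complex.norm_real, Real.norm_eq_abs, abs_of_pos hZ₀pos]
  have hGbd : ∀ z ∈ ball (0 : ℂ) ε, ‖G z‖ ≤ Real.exp (24 * N * ε) := by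
    intro z hz
    rw [mem_ball_zero_iff] at hz
    simp only [hG]
    rw [norm_div, norm_mul, norm_pow, hnormZs0, div_le_iff₀ (by positivity)]
    have h1 := hZs_norm z
    have h2 := hZs_norm (-z)
    rw [norm_neg] at h2
    have h3 : Real.exp (‖z‖ * (12 * N)) ≤ Real.exp (ε * (12 * N)) :=
      Real.exp_le_exp.2 (mul_le_mul_of_nonneg_right hz.le (by positivity))
    calc ‖Zs z‖ * ‖Zs (-z)‖ ≤ (Real.exp (‖z‖ * (12 * N)) * Z₀) * (Real.exp (‖z‖ * (12 * N)) * Z₀) :=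
          mul_le_mul h1 h2 (norm_nonneg _) (by positivity)
      _ ≤ (Real.exp (ε * (12 * N)) * Z₀) * (Real.exp (ε * (12 * N)) * Z₀) := by gcongr
      _ = Real.exp (24 * N * ε) * Z₀ ^ 2 := by
          rw [show 24 * N * ε = ε * (12 * N) + ε * (12 * N) by ring, Real.exp_add]; ring
  have hGeven : ∀ z, G (-z) = G z := by
    intro z; simp only [hG, neg_neg]; ring
  have hGder : deriv G 0 = 0 := cfp_deriv_zero_of_even hGeven
  -- upper bound from zero-freeness
  have hup : Real.log ‖G σ‖ ≤ 8 * (24 * N * ε) / ε ^ 2 * ‖(σ : ℂ)‖ ^ 2 :=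
    cfp_log_norm_le_of_zeroFree hε (by positivity) hGd hG0 hG1 hGbd hGder
      (by rw [Complex.norm_real, Real.norm_eq_abs, abs_of_pos hσpos]; exact hσε)
  rw [Complex.norm_real, Real.norm_eq_abs, abs_of_pos hσpos] at hup
  -- the value `‖G σ‖ = (Z(σ)/Z₀) (Z(−σ)/Z₀)`
  have hGσ : ‖G σ‖ = (Zr σ / Z₀) * (Zr (-σ) / Z₀) := by
    simp only [hG]
    have e1 : Zs (σ : ℂ) = ((Zr σ : ℝ) : ℂ) := hreal σ
    have e2 : Zs (-(σ : ℂ)) = ((Zr (-σ) : ℝ) : ℂ) := by rw [← Complex.ofReal_neg]; exact hreal (-σ)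
    rw [e1, e2, hZs0, ← Complex.ofReal_mul, ← Complex.ofReal_pow, ← Complex.ofReal_div, Complex.norm_real,
      Real.norm_eq_abs, abs_of_pos (div_pos (mul_pos (hZrpos σ) (hZrpos (-σ))) (pow_pos hZ₀pos 2))]
    field_simp
  -- lower bounds: Ward/Jensen side and twisted side
  have hlow1 : σ * (N * a₀ - 1) / J ≤ Real.log (Zr σ / Z₀) := by
    have h1 := gr_rel_lower_pos (L := L) hJpos σ
    have h2 : σ * (N * a₀ - 1) / J ≤ σ * ((L : ℝ) ^ 3 * (cratio L J (0 : Bond L → Bond L → ℂ)).re - 1) / J := by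
      refine div_le_div_of_nonneg_right (mul_le_mul_of_nonneg_left ?_ hσpos.le) hJpos.le
      rw [hN]
      nlinarith [hpl, pow_pos hL0 3]
    exact h2.trans h1
  have hlow2 : -(18 * σ * N / n) - 4 * Real.pi ^ 2 * σ * (n : ℝ) ^ 4 * L - 4 * Real.pi * σ * (n : ℝ) ^ 2 * (L : ℝ) ^ 2 -
      2 * Real.pi ^ 2 * (n : ℝ) ^ 4 * J * L ≤ Real.log (Zr (-σ) / Z₀) :=
    gr_rel_lower_neg (L := L) hL2 hJpos.le hσpos.le hn1 hnL
  have hlog : Real.log ‖G σ‖ = Real.log (Zr σ / Z₀) + Real.log (Zr (-σ) / Z₀) := by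
    rw [hGσ, Real.log_mul (div_pos (hZrpos σ) hZ₀pos).ne' (div_pos (hZrpos (-σ)) hZ₀pos).ne']
  -- combine
  have hε0 : ε ≠ 0 := hε.ne'
  have hkey : σ * (N * a₀ - 1) / J - 18 * σ * N / n - 4 * Real.pi ^ 2 * σ * (n : ℝ) ^ 4 * L -
      4 * Real.pi * σ * (n : ℝ) ^ 2 * (L : ℝ) ^ 2 - 2 * Real.pi ^ 2 * (n : ℝ) ^ 4 * J * L ≤ 192 * N * σ ^ 2 / ε := by
    have : 8 * (24 * N * ε) / ε ^ 2 * σ ^ 2 = 192 * N * σ ^ 2 / ε := by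
      field_simp
      ring
    linarith
  -- `18σN/n ≤ σNa₀/(2J)` and `192Nσ²/ε = σNa₀/(4J)`
  have hni : 18 * σ * N / n ≤ σ * N * a₀ / (2 * J) := by
    rw [div_le_div_iff₀ hn0 (by positivity)]
    have h36 : 36 * J ≤ a₀ * n := by
      have := (div_le_iff₀ ha₀).1 hna
      linarith
    calc 18 * σ * N * (2 * J) = (36 * J) * (σ * N) := by ring
      _ ≤ (a₀ * n) * (σ * N) := mul_le_mul_of_nonneg_right h36 (mul_pos hσpos hNpos).le
      _ = σ * N * a₀ * n := by ring
  have hup2 : 192 * N * σ ^ 2 / ε = σ * N * a₀ / (4 * J) := by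
    rw [hσ]
    field_simp
    ring
  rw [hup2] at hkey
  have hkey2 : σ * N * a₀ / (4 * J) ≤ σ / J + 4 * Real.pi ^ 2 * σ * (n : ℝ) ^ 4 * L +
      4 * Real.pi * σ * (n : ℝ) ^ 2 * (L : ℝ) ^ 2 + 2 * Real.pi ^ 2 * (n : ℝ) ^ 4 * J * L := by
    have e : σ * (N * a₀ - 1) / J = σ * N * a₀ / J - σ / J := by field_simp
    rw [e] at hkey
    have e2 : σ * N * a₀ / J = 4 * (σ * N * a₀ / (4 * J)) := by field_simp
    have e3 : σ * N * a₀ / (2 * J) = 2 * (σ * N * a₀ / (4 * J)) := by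
      field_simp
      norm_num
    linarith [hkey, hni, e2, e3]
  -- divide by `σ` and bound by `C₀ L²`
  have hkey3 : N * a₀ / (4 * J) ≤ C₀ * (L : ℝ) ^ 2 := by
    have hL2r : (L : ℝ) ≤ (L : ℝ) ^ 2 := by
      calc (L : ℝ) = (L : ℝ) * 1 := by ring
        _ ≤ (L : ℝ) * L := mul_le_mul_of_nonneg_left hL1r hL0.le
        _ = (L : ℝ) ^ 2 := by ring
    have hL2r' : (1 : ℝ) ≤ (L : ℝ) ^ 2 := le_trans hL1r hL2r
    have hdivσ : N * a₀ / (4 * J) ≤ 1 / J + 4 * Real.pi ^ 2 * (n : ℝ) ^ 4 * L + 4 * Real.pi * (n : ℝ) ^ 2 * (L : ℝ) ^ 2 +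
        2 * Real.pi ^ 2 * (n : ℝ) ^ 4 * J * L / σ := by
      have e : σ * N * a₀ / (4 * J) = σ * (N * a₀ / (4 * J)) := by ring
      rw [e] at hkey2
      have e2 : σ / J + 4 * Real.pi ^ 2 * σ * (n : ℝ) ^ 4 * L + 4 * Real.pi * σ * (n : ℝ) ^ 2 * (L : ℝ) ^ 2 +
          2 * Real.pi ^ 2 * (n : ℝ) ^ 4 * J * L =
          σ * (1 / J + 4 * Real.pi ^ 2 * (n : ℝ) ^ 4 * L + 4 * Real.pi * (n : ℝ) ^ 2 * (L : ℝ) ^ 2 +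
            2 * Real.pi ^ 2 * (n : ℝ) ^ 4 * J * L / σ) := by
        field_simp
      rw [e2] at hkey2
      exact le_of_mul_le_mul_left hkey2 hσpos
    refine hdivσ.trans ?_
    rw [hC₀]
    have t1 : 1 / J ≤ 1 / J * (L : ℝ) ^ 2 := le_mul_of_one_le_right (by positivity) hL2r'
    have t2 : 4 * Real.pi ^ 2 * (n : ℝ) ^ 4 * L ≤ 4 * Real.pi ^ 2 * (n : ℝ) ^ 4 * (L : ℝ) ^ 2 :=
      mul_le_mul_of_nonneg_left hL2r (by positivity)
    have t4 : 2 * Real.pi ^ 2 * (n : ℝ) ^ 4 * J * L / σ ≤ 2 * Real.pi ^ 2 * (n : ℝ) ^ 4 * J / σ * (L : ℝ) ^ 2 := by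
      rw [div_mul_eq_mul_div, div_le_div_iff_of_pos_right hσpos]
      exact mul_le_mul_of_nonneg_left hL2r (by positivity)
    have e4 : (1 / J + 4 * Real.pi ^ 2 * (n : ℝ) ^ 4 + 4 * Real.pi * (n : ℝ) ^ 2 + 2 * Real.pi ^ 2 * (n : ℝ) ^ 4 * J / σ) *
        (L : ℝ) ^ 2 = 1 / J * (L : ℝ) ^ 2 + 4 * Real.pi ^ 2 * (n : ℝ) ^ 4 * (L : ℝ) ^ 2 + 4 * Real.pi * (n : ℝ) ^ 2 * (L : ℝ) ^ 2 +
        2 * Real.pi ^ 2 * (n : ℝ) ^ 4 * J / σ * (L : ℝ) ^ 2 := by ring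
    linarith [t1, t2, t4, e4]
  -- i.e. `L ≤ B`
  have hfin : (L : ℝ) ≤ B := by
    rw [hB, le_div_iff₀ ha₀]
    have e : N * a₀ / (4 * J) = (L : ℝ) ^ 2 * ((L : ℝ) * a₀ / (4 * J)) := by rw [hN]; ring
    rw [e] at hkey3
    have h5 : (L : ℝ) * a₀ / (4 * J) ≤ C₀ := le_of_mul_le_mul_left (by linarith [hkey3]) (by positivity : (0 : ℝ) < (L : ℝ) ^ 2)
    rw [div_le_iff₀ (by positivity)] at h5
    linarith
  linarith

/-- **The relatively bounded invariant mean-field source is not uniformly zero-free** — the same statement under its natural name (alias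
of the registered stub `stub_invariantRelBoundedPinching`). -/
theorem perturbedXYOrder_false_for_invariant_relBounded_source :
    ¬ (∃ J₀ ε : ℝ, 0 < ε ∧ ∀ J : ℝ, J₀ ≤ J → ∀ (L : ℕ) [NeZero L], 2 ≤ L →
        ∀ s : ℂ, ‖s‖ ≤ ε →
          (∫ θ in cube L, wJ J θ * Complex.exp (s * ((∑ y : TorusSite 3 L, ∑ b : Bond L,
            ((Real.cos (θ b.1 - θ y) : ℂ) + (Real.cos (θ (b.1 + Pi.single b.2 1) - θ y) : ℂ)) *
              (1 - (Real.cos (θ (b.1 + Pi.single b.2 1) - θ b.1) : ℂ))) / (L : ℂ) ^ 3))) ≠ 0) :=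
  stub_invariantRelBoundedPinching

end Summit.HubbardSuperconductivity.HubbardSuperconductivity.Theorems.PerturbedXYOrder

end
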